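import Summits.ResolutionOfSingularities.ResolutionOfSingularities.Theorems.MarkedTransferCampaignW46LargeCharRegime
import Literature.AlgebraicGeometry.Resolution.KollarMaximalContactTame
import HarnessLib

/-!
# [OURS · L1 W4.6, rung (iv) «large characteristic», LEVEL 1] In regime (iv) every state of the TYPED procedure
# of maximal order admits, locally at every point, a hypersurface of MAXIMAL CONTACT in Kollár's sense (Def. 3.78):
# a regular hypersurface containing `Sing(E)` on which EVERY smooth blow-up sequence of order `≥ b` keeps its centres
# (cell res-hironaka, LADDER-RESOLUTION rung L, D-0089; slot W4.6, seat res-L1-s46-pv-7; host route MarkedTransfer,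
# `--supports stmt-ResolutionOfSingularities-16155 --as helper`)

HONEST FRAMING. Nothing here is a statement of H. Hironaka's manuscript (2017-03-23, [Hironaka2017]) and nothing here
asserts that any statement of it holds. OURS corollaries, over the shared typed-procedure module
`MarkedTransferCampaignW46TypedProcedure` (res-L1-type-o1: `CampaignW46.Regime.charGT`; the manuscript enters only
through the typed CANDIDATE carriers `AmbientDatum`, `IdealExponent`, `IdealExponent.sing`, `IsPermissibleCentre`, used
as definitions), of the TREE's Kollár layer in its tame range — this seat's
`Literature/AlgebraicGeometry/Resolution/KollarMaximalContactTame.lean` (p525015: Kollár 2007 Thm. 3.80 (1) ∧ (2) for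
`X` smooth over a perfect field of characteristic `p` and `1 ≤ m < p`). No premise of the manuscript, no FACT-LIST
premise. AI review is weaker than expert review. No `sorry`, no new definition; axioms standard.

## What this file pins («reduction to the characteristic-zero-like regime», one level below the tangent cone)

The host thesis (route MarkedTransfer) locates the FIRST step of the characteristic-zero induction that does not
transfer to characteristic `p` at Kollár's Lemma 3.74 (3) ⇒ Thm. 3.80 — hypersurfaces of maximal contact
(`Kollar2007.exists_maxContact_nhd [CharZero k]`). In regime (iv) := `Regime.charGT n (fun _ b ↦ b)` («`p > b`», the
honest threshold of this seat's gen-2 files, `TameRegime.charGT_order_iff`) that step DOES transfer: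

* `exists_isMaxContact_nhd_of_charGT` — for a state `(A, E)`, `E = (J, b)`, of the typed procedure over a PERFECT
  field `K` of characteristic `p`, in regime (iv), with `1 ≤ b` and `J` of maximal order `b` (`ord_ξ J ≤ b` at every
  point — the situation of an ideal exponent at the top of its Samuel stratification), every point `ξ ∈ Z` has an
  open neighbourhood `U` and an ideal sheaf `H` on `U` such that: `H` is the ideal of a REGULAR HYPERSURFACE
  (`H_y = (v)`, `v ∉ 𝔪_y²` at every `y ∈ V(H)`); `Sing(E) ∩ U ⊆ V(H)`; and `H` IS A HYPERSURFACE OF MAXIMAL CONTACT for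
  `(J|_U, b)` in the sense of Kollár's Def. 3.78 (tree `Kollar2007.IsMaxContact`): for every open `U⁰ ⊆ U` and every
  smooth blow-up sequence of order `≥ b` starting with `(U⁰, J|_{U⁰}, b)` (tree `CentreSeq.IsAdmissibleFor`: regular
  centres inside the order-`≥ b` locus of the successive controlled transforms — the transform law of the typed
  `IdealExponent.transform`, Def. 2.1), ALL centres lie on the successive strict (= birational) transforms of `H`.
  This is Kollár's Thm. 3.80 read at the typed state (`Kollar2007.exists_isMaxContact_nhd_of_char` with `m := b < p`);
* `exists_isMaxContact_nhd_of_le` — the same in every regime `Regime.charGT n f` with `(fun _ b ↦ b) ≤ f` (e.g. the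
  prior's V5 threshold `fun _ b ↦ b !`), by this seat's `Regime.charGT_of_le` (p471737);
* `subset_support_of_subset_sing` / `centre_subset_support_of_isPermissibleCentre` — in particular every centre
  that is permissible FOR `E` in the sense of §2.1 (typed `IdealExponent.IsPermissibleCentre`: `D ⊆ Sing(E)`; the
  sibling reading `IsCentrePermE` of the shared module) meets `U` inside the maximal-contact hypersurface `V(H)`.

What is NOT here: the identification of a typed `Run`/`RunNabla` (blow-ups `IsBlowup π (𝓘_D)` of arbitrary models)
with a tree `CentreSeq` (the chosen models `blowup C`) — an isomorphism-transport dictionary; with it,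
`IsMaxContact` says literally that every permissible run in regime (iv) is the push-forward of a run on the
maximal-contact hypersurface (Kollár 3.30.2–3), i.e. the induction on the dimension of the characteristic-zero
proof is available at level 1. The threshold is sharp for the derivation-based machinery at every `b ≥ p`
(`Literature/…/MaximalContactConeCriterion.lean`, this seat) and for geometry at wild points (barrier
`Literature.Barriers.ResolutionOfSingularities.NarasimhanMaximalContact`, `b = p = 2`).

## References (context; nothing is cited as a premise)

* J. Kollár, *Lectures on Resolution of Singularities* (2007), Def. 3.78, Thm. 3.80, Aside 3.57 — through the tree's
  `KollarMaximalContact.lean` / `KollarMaximalContactTame.lean`. [cite: Kollar2007, Thm. 3.80]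
* E. Bierstone, D. Grigoriev, P. Milman, J. Włodarczyk (2011), Thm. 8.0.4 («the characteristic-zero algorithm runs for
  multiplicities `< p`»). [cite: BierstoneGrigorievMilmanWlodarczyk2011, Thm. 8.0.4]
* `Theorems/MarkedTransferCampaignW46TypedProcedure.lean` (DESIGN POINT (REG) (iv)); this seat's p471737, p483854.
-/

noncomputable section

set_option linter.dupNamespace false -- mandated namespace of this single-conjunct summit

open CategoryTheory AlgebraicGeometry TopologicalSpace IsLocalRing

namespace Summit.ResolutionOfSingularities.ResolutionOfSingularities.Theorems
namespace CampaignW46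
namespace TameMaximalContact

open Literature.AlgebraicGeometry.Resolution
open Literature.AlgebraicGeometry.Hironaka2017.S02Preliminaries

universe u

variable {n : ℕ} {p : ℕ} [Fact p.Prime] {K : Type u} [Field K] [CharP K p]

/-- [OURS · L1 W4.6 (iv)] `Sing(E)` of the typed ideal exponent `E = (J, b)` (row 001 `IdealExponent.sing`: the points
of order `≥ b`) IS the tree's cosupport `supp(J, ∅, b)` of the marked ideal `(J, b)` (BGMW Def. 3.1.2). [folklore] -/
theorem sing_eq_support {Z : Scheme.{u}} (E : IdealExponent Z) :
    E.sing = (⟨E.J, [], E.b⟩ : MarkedIdeal Z).support :=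
  rfl

/-- [OURS · L1 W4.6 (iv); NOT a statement of the manuscript] **In regime (iv) every state of maximal order has local
hypersurfaces of MAXIMAL CONTACT (Kollár Def. 3.78 / Thm. 3.80).** For `(A, E)`, `E = (J, b)`, over a perfect field `K`
of characteristic `p`, in `Regime.charGT n (fun _ b ↦ b)` (`b < p`), with `1 ≤ b` and `ord_ξ J ≤ b` everywhere: every
`ξ ∈ Z` has an open `U ∋ ξ` and an ideal sheaf `H` on `U` of a regular hypersurface (`H_y = (v)`, `v ∉ 𝔪_y²` on
`V(H)`), with `Sing(E) ∩ U ⊆ V(H)`, which is a hypersurface of maximal contact for `(J|_U, b)`: every smooth blow-up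
sequence of order `≥ b` over every open `U⁰ ⊆ U` keeps all its centres on the birational transforms of `H`
(`Kollar2007.IsMaxContact`). Instance of this seat's `Kollar2007.exists_isMaxContact_nhd_of_char` (Kollár Thm. 3.80 in
the tame range `m < p`) at `X := Z`, `I := J`, `m := b`. [cite: Kollar2007, Thm. 3.80] -/
theorem exists_isMaxContact_nhd_of_charGT [PerfectField K] (A : AmbientDatum p K) (E : IdealExponent A.Z)
    (hE : Regime.charGT (p := p) (K := K) n (fun _ b => b) A E) (hb : 1 ≤ E.b)
    (hmax : ∀ ξ : A.Z, idealOrder E.J ξ ≤ E.b) (ξ : A.Z) :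
    ∃ (U : A.Z.Opens) (_ : ξ ∈ U) (H : (U : Scheme.{u}).IdealSheafData),
      (∀ y ∈ H.support, ∃ v : (U : Scheme.{u}).presheaf.stalk y,
          stalkIdeal H y = Ideal.span {v} ∧ v ∉ (maximalIdeal ((U : Scheme.{u}).presheaf.stalk y)) ^ 2) ∧
        (∀ y : (U : Scheme.{u}), y.1 ∈ E.sing → y ∈ H.support) ∧
        Kollar2007.IsMaxContact (E.J.comap U.ι) E.b H := by
  letI : A.Z.Over (Spec (.of K)) := ⟨A.hom⟩
  haveI : Smooth (A.Z ↘ Spec (.of K)) := A.smooth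
  have hbp : E.b < p := hE
  obtain ⟨U, hξU, H, -, hreg, hsub, hmc⟩ :=
    Kollar2007.exists_isMaxContact_nhd_of_char K A.Z p E.J hb (Or.inr hbp) hmax ξ
  refine ⟨U, hξU, H, hreg, fun y hy => hsub ?_, hmc⟩
  rw [MarkedIdeal.support_comap_of_isOpenImmersion]
  exact hy

/-- [OURS · L1 W4.6 (iv)] The same in every large-characteristic regime `Regime.charGT n f` whose threshold dominates
the order, `(fun _ b ↦ b) ≤ f` — e.g. the prior's V5 threshold `fun _ b ↦ b !` for the next level
(`TameRegime.order_le_factorial`) — by `Regime.charGT_of_le` (p471737). [cite: Kollar2007, Thm. 3.80] -/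
theorem exists_isMaxContact_nhd_of_le [PerfectField K] {f : ℕ → ℕ → ℕ} (hf : (fun _ b : ℕ => b) ≤ f)
    (A : AmbientDatum p K) (E : IdealExponent A.Z) (hE : Regime.charGT (p := p) (K := K) n f A E) (hb : 1 ≤ E.b)
    (hmax : ∀ ξ : A.Z, idealOrder E.J ξ ≤ E.b) (ξ : A.Z) :
    ∃ (U : A.Z.Opens) (_ : ξ ∈ U) (H : (U : Scheme.{u}).IdealSheafData),
      (∀ y ∈ H.support, ∃ v : (U : Scheme.{u}).presheaf.stalk y,
          stalkIdeal H y = Ideal.span {v} ∧ v ∉ (maximalIdeal ((U : Scheme.{u}).presheaf.stalk y)) ^ 2) ∧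
        (∀ y : (U : Scheme.{u}), y.1 ∈ E.sing → y ∈ H.support) ∧
        Kollar2007.IsMaxContact (E.J.comap U.ι) E.b H :=
  exists_isMaxContact_nhd_of_charGT A E (Regime.charGT_of_le (fun b => hf n b) A E hE) hb hmax ξ

/-- [OURS · L1 W4.6 (iv)] Bookkeeping: a subset of `Sing(E)` meets the neighbourhood `U` inside `V(H)` whenever
`Sing(E) ∩ U ⊆ V(H)` (the shape of the second clause above). [folklore] -/
theorem subset_support_of_subset_sing {A : AmbientDatum p K} {E : IdealExponent A.Z} {U : A.Z.Opens}
    {H : (U : Scheme.{u}).IdealSheafData} (hH : ∀ y : (U : Scheme.{u}), y.1 ∈ E.sing → y ∈ H.support)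
    {D : Set A.Z} (hD : D ⊆ E.sing) (y : (U : Scheme.{u})) (hy : y.1 ∈ D) : y ∈ H.support :=
  hH y (hD hy)

/-- [OURS · L1 W4.6 (iv); NOT a statement of the manuscript] **Permissible centres lie on the maximal-contact
hypersurface.** With `U, H` as produced by `exists_isMaxContact_nhd_of_charGT`, every centre `D` permissible FOR `E`
(§2.1 p.4 l.37–39 as typed: `IdealExponent.IsPermissibleCentre`, in particular `D ⊆ Sing(E)`; the shared module's
sibling centre rule `IsCentrePermE`) satisfies `D ∩ U ⊆ V(H)` — the first instance («`Z_0 ⊂ H`») of Def. 3.78.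
[cite: Kollar2007, Def. 3.78] -/
theorem centre_subset_support_of_isPermissibleCentre {A : AmbientDatum p K} {E : IdealExponent A.Z}
    {U : A.Z.Opens} {H : (U : Scheme.{u}).IdealSheafData}
    (hH : ∀ y : (U : Scheme.{u}), y.1 ∈ E.sing → y ∈ H.support) {D : Closeds A.Z}
    (hD : E.IsPermissibleCentre A.hom D) (y : (U : Scheme.{u})) (hy : y.1 ∈ (D : Set A.Z)) :
    y ∈ H.support :=
  subset_support_of_subset_sing hH hD.subset_sing y hy

end TameMaximalContact
end CampaignW46
end Summit.ResolutionOfSingularities.ResolutionOfSingularities.Theorems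

end
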